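import Summits.Parity.BatemanHorn.Theorems.SoloInformedMoebiusBVInput

/-!
# SoloInformedTwinUnbalancedLiteBound — the unbalanced twin sum when every cofactor is small

Solo unit `solo-Parity-informed` (ideation tier, informed mode), session 80; `paper.md` §20
(Theorem 20.1 = (F′)), PLAN §63.3–63.5 ("F5-lite", first half), CLAIMS C144.

After divisor switching (`SoloInformedTwinUnbalancedSwitch`, `…Pieces`) the unbalanced part
`U(x; y, z)` of the located twin sum is `∑_{q ≤ z}` of four switched sums `S(lo,hi; q, r₀, a)(w_q)`,
each `μ(q)·(log²q·S(P₀) + 2 log q·S(P₁) + S(P₂))` with `S(P_j) = ∑_k 𝟙[(k,r₀)=1]·innerP_j(q,k)`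
(packaging P, `SoloInformedTwinUnbalancedSmallClass`).  The inner class sum `innerP_j(q,k)` lives
on `y/q < e ≤ hi/k`, so it VANISHES unless `k < hi·q/y`: for `hi·z ≤ (K+1)·y` the cofactor sum is
its truncation to `k ≤ K` (`sum_indicator_innerP_eq_trunc`).  If this `K` lies in regime (1a) of
`SoloInformedMoebiusBVInput.sum_abs_innerP_small_le_base` — `K (2z log^B)² ≤ hi`, `K X^{1/2} ≤ hi`
— then Bombieri–Vinogradov for `μ` alone bounds everything:

  `|U(x; y, z)| ≤ C x (log x)^{-A}`     (`abs_twinUnbalancedSum_le_of_regime`)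

for `x ≥ X₀(A)`, `z² ≤ y`, `z ≤ x`, `(x+2) z ≤ (K+1) y`, `K (2z log^B(x+2))² ≤ ⌊x/2⌋`,
`K (x+2)^{1/2} ≤ ⌊x/2⌋`.  With `y = ⌊x^{1-ε}⌋`, `z = ⌊x^{1/2-ε₀}⌋` these side conditions hold for
all large `x` exactly when `3ε₀ > 1/2 + ε` (second half, the asymptotic file); no bilinear-form
input (BFI Theorem 0(b)) is needed in that range.
-/

namespace Summit.Parity.BatemanHorn.Theorems

open Finset Real
open scoped ArithmeticFunction.Moebius

/-! ### 1. Truncation of the cofactor sum -/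

/-- `innerP_j(q,k) = 0` when `hi/k ≤ y/q`: the e-range `(max(y/q,·), hi/k]` is empty. -/
theorem innerP_eq_zero_of_div_le {q k lo hi y : ℕ} (h : hi / k ≤ y / q) (j r₀ : ℕ) (a : ℤ) :
    innerP j r₀ lo hi y a q k = 0 := by
  unfold innerP
  refine sum_eq_zero fun e _ => ?_
  split_ifs with hc
  · rw [moebiusLogPiece, if_neg]
    rintro ⟨h1, h2, -⟩
    have h3 : y / q < e := lt_of_le_of_lt (le_max_left _ _) h1
    exact absurd (lt_of_lt_of_le h3 h2) (not_lt.mpr h)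
  · rfl

/-- For `0 < q ≤ z` and `hi·z ≤ (K+1)·y` the cofactors `k > K` contribute nothing (and cofactors
`k > hi` never do): the cofactor sum over `Icc 1 hi` equals the one over `Icc 1 K`. -/
theorem sum_indicator_innerP_eq_trunc {q z K hi y : ℕ} (hq : 0 < q) (hqz : q ≤ z)
    (hK : hi * z ≤ (K + 1) * y) (j r₀ lo : ℕ) (a : ℤ) :
    ∑ k ∈ Icc 1 hi, (if k.Coprime r₀ then (1 : ℝ) else 0) * innerP j r₀ lo hi y a q k
      = ∑ k ∈ Icc 1 K, (if k.Coprime r₀ then (1 : ℝ) else 0) * innerP j r₀ lo hi y a q k := by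
  have hzero : ∀ k, hi < k ∨ K < k →
      (if k.Coprime r₀ then (1 : ℝ) else 0) * innerP j r₀ lo hi y a q k = 0 := by
    intro k hk
    have hdiv : hi / k ≤ y / q := by
      rcases hk with hk | hk
      · rw [Nat.div_eq_of_lt hk]; exact Nat.zero_le _
      · have hk0 : 0 < k := by omega
        rw [Nat.le_div_iff_mul_le hq]
        refine Nat.le_of_mul_le_mul_left ?_ hk0
        calc k * (hi / k * q) = k * (hi / k) * q := by ring
          _ ≤ hi * q := Nat.mul_le_mul_right q (Nat.mul_div_le hi k)
          _ ≤ hi * z := Nat.mul_le_mul_left hi hqz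
          _ ≤ (K + 1) * y := hK
          _ ≤ k * y := Nat.mul_le_mul_right y hk
    rw [innerP_eq_zero_of_div_le hdiv, mul_zero]
  have hsub1 : Icc 1 hi ⊆ Icc 1 (max hi K) := Icc_subset_Icc_right (le_max_left _ _)
  have hsub2 : Icc 1 K ⊆ Icc 1 (max hi K) := Icc_subset_Icc_right (le_max_right _ _)
  rw [sum_subset hsub1 fun k hk hk' => hzero k ?_, sum_subset hsub2 fun k hk hk' => hzero k ?_]
  · rw [mem_Icc] at hk hk'; omega
  · rw [mem_Icc] at hk hk'; omega

/-! ### 2. The weight `w_q` costs `(log X)²` -/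

/-- `|S(w_q)| ≤ (log X)² (|S(P₀)| + |S(P₁)| + |S(P₂)|)` for `1 ≤ q ≤ X`, `X ≥ 9`. -/
theorem abs_switchedSum_twinSwitchWeight_le_logSq {q : ℕ} (hq : 0 < q) {X : ℝ}
    (hqX : (q : ℝ) ≤ X) (hX : 9 ≤ X) (lo hi r₀ y : ℕ) (a : ℤ) :
    |switchedSum lo hi q r₀ a (twinSwitchWeight y q)|
      ≤ Real.log X ^ 2 * (|switchedSum lo hi q r₀ a (moebiusLogCut y q 0)|
          + |switchedSum lo hi q r₀ a (moebiusLogCut y q 1)|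
          + |switchedSum lo hi q r₀ a (moebiusLogCut y q 2)|) := by
  have h := abs_switchedSum_twinSwitchWeight_le hq lo hi r₀ y a
  have hL2 : 2 ≤ Real.log X := two_le_log_of_nine_le hX
  have hlq0 : 0 ≤ Real.log q := Real.log_natCast_nonneg q
  have hlq : Real.log q ≤ Real.log X := Real.log_le_log (by exact_mod_cast hq) hqX
  have h0 : Real.log q ^ 2 ≤ Real.log X ^ 2 := pow_le_pow_left₀ hlq0 hlq 2
  have h1 : 2 * Real.log q ≤ Real.log X ^ 2 := by nlinarith
  have h2 : (1 : ℝ) ≤ Real.log X ^ 2 := by nlinarith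
  refine h.trans ?_
  have e0 := mul_le_mul_of_nonneg_right h0
    (abs_nonneg (switchedSum lo hi q r₀ a (moebiusLogCut y q 0)))
  have e1 := mul_le_mul_of_nonneg_right h1
    (abs_nonneg (switchedSum lo hi q r₀ a (moebiusLogCut y q 1)))
  have e2 := le_mul_of_one_le_left
    (abs_nonneg (switchedSum lo hi q r₀ a (moebiusLogCut y q 2))) h2
  linarith

/-! ### 3. One switched sum, summed over the moduli `q ≤ z` -/

/-- For one configuration `(lo, hi, r₀, a)` of the admissible family (`r₀ = 1`, or `r₀ = 2` with
`2 ∣ a`; `a` prime to the moduli prime to `r₀`) and every `A > 0`: there are `B > 0`, `C ≥ 0`, `X₀`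
with `∑_{q ≤ z} |S(lo,hi;q,r₀,a)(w_q)| ≤ C X (log X)^{-A}` whenever `X ≥ X₀`, `1 ≤ lo`, `hi ≤ X`,
`z ≤ X`, `hi·z ≤ (K+1)·y` and `K` is in regime (1a): `K (2z (log X)^B)² ≤ hi`, `K X^{1/2} ≤ hi`. -/
theorem sum_abs_switchedSum_twinSwitchWeight_le {r₀ : ℕ} {a : ℤ}
    (hfam : r₀ = 1 ∨ (r₀ = 2 ∧ (2 : ℤ) ∣ a)) (ha : ∀ q : ℕ, q.Coprime r₀ → IsCoprime (q : ℤ) a)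
    (A : ℝ) (hA : 0 < A) :
    ∃ B C X₀ : ℝ, 0 < B ∧ 0 ≤ C ∧ ∀ X : ℝ, X₀ ≤ X → ∀ lo hi y z K : ℕ, 1 ≤ lo →
      (hi : ℝ) ≤ X → (z : ℝ) ≤ X → hi * z ≤ (K + 1) * y →
      (K : ℝ) * (2 * z * Real.log X ^ B) ^ 2 ≤ hi → (K : ℝ) * X ^ (1 / 2 : ℝ) ≤ hi →
      ∑ q ∈ Icc 1 z, |switchedSum lo hi q r₀ a (twinSwitchWeight y q)|
        ≤ C * X / Real.log X ^ A := by
  have hA2 : 0 < A + 2 := by linarith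
  obtain ⟨B₀, C₀, X₀, hB₀, hC₀, h₀⟩ := sum_abs_innerP_small_le_base 0 hfam ha (A + 2) hA2
  obtain ⟨B₁, C₁, X₁, hB₁, hC₁, h₁⟩ := sum_abs_innerP_small_le_base 1 hfam ha (A + 2) hA2
  obtain ⟨B₂, C₂, X₂, hB₂, hC₂, h₂⟩ := sum_abs_innerP_small_le_base 2 hfam ha (A + 2) hA2
  set B : ℝ := max B₀ (max B₁ B₂) with hBdef
  refine ⟨B, C₀ + C₁ + C₂, max (max X₀ (max X₁ X₂)) 9, lt_max_of_lt_left hB₀, by positivity, ?_⟩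
  intro X hX lo hi y z K hlo hhi hzX hKy hK1 hK2
  have hX9 : 9 ≤ X := le_trans (le_max_right _ _) hX
  have hX' : max X₀ (max X₁ X₂) ≤ X := le_trans (le_max_left _ _) hX
  have hX₀ : X₀ ≤ X := le_trans (le_max_left _ _) hX'
  have hX₁ : X₁ ≤ X := le_trans (le_trans (le_max_left _ _) (le_max_right _ _)) hX'
  have hX₂ : X₂ ≤ X := le_trans (le_trans (le_max_right _ _) (le_max_right _ _)) hX'
  have hL2 : 2 ≤ Real.log X := two_le_log_of_nine_le hX9
  have hL0 : 0 < Real.log X := by linarith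
  have hL1 : 1 ≤ Real.log X := by linarith
  -- the regime condition with each `B_j ≤ B`
  have hreg : ∀ B' : ℝ, B' ≤ B → (K : ℝ) * (2 * z * Real.log X ^ B') ^ 2 ≤ hi := by
    intro B' hB'
    refine le_trans ?_ hK1
    have hpow : Real.log X ^ B' ≤ Real.log X ^ B := Real.rpow_le_rpow_of_exponent_le hL1 hB'
    have h0' : 0 ≤ 2 * (z : ℝ) * Real.log X ^ B' :=
      mul_nonneg (by positivity) (Real.rpow_nonneg hL0.le _)
    exact mul_le_mul_of_nonneg_left
      (pow_le_pow_left₀ h0' (mul_le_mul_of_nonneg_left hpow (by positivity)) 2) (Nat.cast_nonneg K)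
  have hB₀le : B₀ ≤ B := le_max_left _ _
  have hB₁le : B₁ ≤ B := le_trans (le_max_left _ _) (le_max_right _ _)
  have hB₂le : B₂ ≤ B := le_trans (le_max_right _ _) (le_max_right _ _)
  -- the three truncated cofactor sums and their bounds
  have hT : ∀ j, ∀ q ∈ Icc 1 z, switchedSum lo hi q r₀ a (moebiusLogCut y q j)
      = ∑ k ∈ Icc 1 K, (if k.Coprime r₀ then (1 : ℝ) else 0) * innerP j r₀ lo hi y a q k := by
    intro j q hq
    rw [mem_Icc] at hq
    rw [switchedSum_moebiusLogCut_eq_sum_innerP hq.1 hlo,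
      sum_indicator_innerP_eq_trunc hq.1 hq.2 hKy]
  have hS0 := h₀ X hX₀ lo hi y z K hhi (hreg B₀ hB₀le) hK2
  have hS1 := h₁ X hX₁ lo hi y z K hhi (hreg B₁ hB₁le) hK2
  have hS2 := h₂ X hX₂ lo hi y z K hhi (hreg B₂ hB₂le) hK2
  -- per modulus: the weight costs `(log X)²`
  have hq_le : ∀ q ∈ Icc 1 z, |switchedSum lo hi q r₀ a (twinSwitchWeight y q)|
      ≤ Real.log X ^ 2 *
        (|∑ k ∈ Icc 1 K, (if k.Coprime r₀ then (1 : ℝ) else 0) * innerP 0 r₀ lo hi y a q k|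
        + |∑ k ∈ Icc 1 K, (if k.Coprime r₀ then (1 : ℝ) else 0) * innerP 1 r₀ lo hi y a q k|
        + |∑ k ∈ Icc 1 K, (if k.Coprime r₀ then (1 : ℝ) else 0) * innerP 2 r₀ lo hi y a q k|) := by
    intro q hq
    have hq' := hq
    rw [mem_Icc] at hq'
    have hqX : (q : ℝ) ≤ X := le_trans (by exact_mod_cast hq'.2) hzX
    rw [← hT 0 q hq, ← hT 1 q hq, ← hT 2 q hq]
    exact abs_switchedSum_twinSwitchWeight_le_logSq hq'.1 hqX hX9 lo hi r₀ y a
  have hsplit : Real.log X ^ (A + 2) = Real.log X ^ A * Real.log X ^ 2 := by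
    rw [Real.rpow_add hL0, show (2 : ℝ) = ((2 : ℕ) : ℝ) by norm_num, Real.rpow_natCast]
  have hLA : 0 < Real.log X ^ A := Real.rpow_pos_of_pos hL0 _
  calc ∑ q ∈ Icc 1 z, |switchedSum lo hi q r₀ a (twinSwitchWeight y q)|
      ≤ ∑ q ∈ Icc 1 z, Real.log X ^ 2 *
        (|∑ k ∈ Icc 1 K, (if k.Coprime r₀ then (1 : ℝ) else 0) * innerP 0 r₀ lo hi y a q k|
        + |∑ k ∈ Icc 1 K, (if k.Coprime r₀ then (1 : ℝ) else 0) * innerP 1 r₀ lo hi y a q k|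
        + |∑ k ∈ Icc 1 K, (if k.Coprime r₀ then (1 : ℝ) else 0) * innerP 2 r₀ lo hi y a q k|) :=
        sum_le_sum hq_le
    _ = Real.log X ^ 2 *
        (∑ q ∈ Icc 1 z,
            |∑ k ∈ Icc 1 K, (if k.Coprime r₀ then (1 : ℝ) else 0) * innerP 0 r₀ lo hi y a q k|
          + ∑ q ∈ Icc 1 z,
            |∑ k ∈ Icc 1 K, (if k.Coprime r₀ then (1 : ℝ) else 0) * innerP 1 r₀ lo hi y a q k|
          + ∑ q ∈ Icc 1 z,
            |∑ k ∈ Icc 1 K, (if k.Coprime r₀ then (1 : ℝ) else 0) * innerP 2 r₀ lo hi y a q k|) := by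
        rw [← mul_sum, sum_add_distrib, sum_add_distrib]
    _ ≤ Real.log X ^ 2 * (C₀ * X / Real.log X ^ (A + 2) + C₁ * X / Real.log X ^ (A + 2)
          + C₂ * X / Real.log X ^ (A + 2)) :=
        mul_le_mul_of_nonneg_left (add_le_add_three hS0 hS1 hS2) (by positivity)
    _ = (C₀ + C₁ + C₂) * X / Real.log X ^ A := by
        rw [hsplit]
        field_simp

/-! ### 4. The four configurations: `|U(x; y, z)|` in regime (1a) -/

/-- **The unbalanced twin sum when every cofactor is small.**  For every `A > 0` there are
`B > 0`, `C ≥ 0`, `X₀` such that `|U(x; y, z)| ≤ C x (log x)^{-A}` whenever `x ≥ X₀`, `z² ≤ y`,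
`z ≤ x`, `(x+2)·z ≤ (K+1)·y`, `K (2z (log(x+2))^B)² ≤ ⌊x/2⌋` and `K (x+2)^{1/2} ≤ ⌊x/2⌋` for some
`K` (then all cofactors are `≤ K` and in regime (1a) for each of the four switched sums). -/
theorem abs_twinUnbalancedSum_le_of_regime (A : ℝ) (hA : 0 < A) :
    ∃ B C X₀ : ℝ, 0 < B ∧ 0 ≤ C ∧ ∀ x y z K : ℕ, X₀ ≤ (x : ℝ) → z * z ≤ y → z ≤ x →
      (x + 2) * z ≤ (K + 1) * y →
      (K : ℝ) * (2 * z * Real.log ((x : ℝ) + 2) ^ B) ^ 2 ≤ ((x / 2 : ℕ) : ℝ) →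
      (K : ℝ) * ((x : ℝ) + 2) ^ (1 / 2 : ℝ) ≤ ((x / 2 : ℕ) : ℝ) →
      |twinUnbalancedSum x y z| ≤ C * x / Real.log x ^ A := by
  -- the four admissible configurations `(r₀, a) = (2, 2), (1, 1), (2, -2), (1, -1)`
  have ha2 : ∀ q : ℕ, q.Coprime 2 → IsCoprime (q : ℤ) 2 := fun q hq =>
    (Nat.isCoprime_iff_coprime.mpr hq : IsCoprime (q : ℤ) ((2 : ℕ) : ℤ))
  have ha2' : ∀ q : ℕ, q.Coprime 2 → IsCoprime (q : ℤ) (-2) := fun q hq => (ha2 q hq).neg_right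
  have ha1 : ∀ q : ℕ, q.Coprime 1 → IsCoprime (q : ℤ) 1 := fun q _ => isCoprime_one_right
  have ha1' : ∀ q : ℕ, q.Coprime 1 → IsCoprime (q : ℤ) (-1) := fun q _ =>
    isCoprime_one_right.neg_right
  obtain ⟨B₁, C₁, X₁, hB₁, hC₁, h₁⟩ := sum_abs_switchedSum_twinSwitchWeight_le
    (r₀ := 2) (a := 2) (Or.inr ⟨rfl, dvd_rfl⟩) ha2 A hA
  obtain ⟨B₂, C₂, X₂, hB₂, hC₂, h₂⟩ := sum_abs_switchedSum_twinSwitchWeight_le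
    (r₀ := 1) (a := 1) (Or.inl rfl) ha1 A hA
  obtain ⟨B₃, C₃, X₃, hB₃, hC₃, h₃⟩ := sum_abs_switchedSum_twinSwitchWeight_le
    (r₀ := 2) (a := -2) (Or.inr ⟨rfl, ⟨-1, by norm_num⟩⟩) ha2' A hA
  obtain ⟨B₄, C₄, X₄, hB₄, hC₄, h₄⟩ := sum_abs_switchedSum_twinSwitchWeight_le
    (r₀ := 1) (a := -1) (Or.inl rfl) ha1' A hA
  set B : ℝ := max (max B₁ B₂) (max B₃ B₄) with hBdef
  refine ⟨B, 3 * (C₁ + C₂ + C₃ + C₄), max (max (max X₁ X₂) (max X₃ X₄)) 9,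
    lt_max_of_lt_left (lt_max_of_lt_left hB₁), by positivity, ?_⟩
  intro x y z K hx hzy hzx hKy hK1 hK2
  have hx9 : (9 : ℝ) ≤ x := le_trans (le_max_right _ _) hx
  have hx' : max (max X₁ X₂) (max X₃ X₄) ≤ (x : ℝ) := le_trans (le_max_left _ _) hx
  set X : ℝ := (x : ℝ) + 2 with hXdef
  have hxX : (x : ℝ) ≤ X := by rw [hXdef]; linarith
  have hX₁ : X₁ ≤ X := le_trans (le_trans (le_max_left _ _) (le_max_left _ _)) (hx'.trans hxX)
  have hX₂ : X₂ ≤ X := le_trans (le_trans (le_max_right _ _) (le_max_left _ _)) (hx'.trans hxX)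
  have hX₃ : X₃ ≤ X := le_trans (le_trans (le_max_left _ _) (le_max_right _ _)) (hx'.trans hxX)
  have hX₄ : X₄ ≤ X := le_trans (le_trans (le_max_right _ _) (le_max_right _ _)) (hx'.trans hxX)
  have hX9 : 9 ≤ X := hx9.trans hxX
  have hLX2 : 2 ≤ Real.log X := two_le_log_of_nine_le hX9
  have hLX0 : 0 < Real.log X := by linarith
  have hLX1 : 1 ≤ Real.log X := by linarith
  have hzX : (z : ℝ) ≤ X := le_trans (by exact_mod_cast hzx) hxX
  -- the four `hi`'s: `x/2 ≤ hi ≤ x + 2`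
  have hhalf_le : ((x / 2 : ℕ) : ℝ) ≤ x := by exact_mod_cast Nat.div_le_self x 2
  have hhi1 : ((x + 2 : ℕ) : ℝ) ≤ X := by rw [hXdef]; push_cast; exact le_rfl
  have hhi2 : ((x / 2 + 1 : ℕ) : ℝ) ≤ X := by rw [hXdef]; push_cast; linarith
  have hhi3 : ((x : ℕ) : ℝ) ≤ X := hxX
  have hhi4 : ((x / 2 : ℕ) : ℝ) ≤ X := hhalf_le.trans hxX
  have hlo1 : ((x / 2 : ℕ) : ℝ) ≤ ((x + 2 : ℕ) : ℝ) := by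
    exact_mod_cast (Nat.div_le_self x 2).trans (Nat.le_add_right x 2)
  have hlo2 : ((x / 2 : ℕ) : ℝ) ≤ ((x / 2 + 1 : ℕ) : ℝ) := by exact_mod_cast Nat.le_succ _
  have hlo3 : ((x / 2 : ℕ) : ℝ) ≤ ((x : ℕ) : ℝ) := hhalf_le
  -- the truncation hypotheses `hi·z ≤ (K+1)·y`
  have hKy1 : (x + 2) * z ≤ (K + 1) * y := hKy
  have hKy2 : (x / 2 + 1) * z ≤ (K + 1) * y :=
    le_trans (Nat.mul_le_mul_right z (by omega)) hKy
  have hKy3 : x * z ≤ (K + 1) * y := le_trans (Nat.mul_le_mul_right z (by omega)) hKy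
  have hKy4 : (x / 2) * z ≤ (K + 1) * y :=
    le_trans (Nat.mul_le_mul_right z ((Nat.div_le_self x 2).trans (by omega))) hKy
  -- the regime conditions with each `B_i ≤ B` and each `hi ≥ x/2`
  have hreg : ∀ B' : ℝ, B' ≤ B → ∀ {h : ℝ}, ((x / 2 : ℕ) : ℝ) ≤ h →
      (K : ℝ) * (2 * z * Real.log X ^ B') ^ 2 ≤ h := by
    intro B' hB' h hh
    refine le_trans ?_ (hK1.trans hh)
    have hpow : Real.log X ^ B' ≤ Real.log X ^ B := Real.rpow_le_rpow_of_exponent_le hLX1 hB'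
    have h0' : 0 ≤ 2 * (z : ℝ) * Real.log X ^ B' :=
      mul_nonneg (by positivity) (Real.rpow_nonneg hLX0.le _)
    exact mul_le_mul_of_nonneg_left
      (pow_le_pow_left₀ h0' (mul_le_mul_of_nonneg_left hpow (by positivity)) 2) (Nat.cast_nonneg K)
  have hreg' : ∀ {h : ℝ}, ((x / 2 : ℕ) : ℝ) ≤ h → (K : ℝ) * X ^ (1 / 2 : ℝ) ≤ h :=
    fun hh => hK2.trans hh
  have hB₁le : B₁ ≤ B := le_trans (le_max_left _ _) (le_max_left _ _)
  have hB₂le : B₂ ≤ B := le_trans (le_max_right _ _) (le_max_left _ _)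
  have hB₃le : B₃ ≤ B := le_trans (le_max_left _ _) (le_max_right _ _)
  have hB₄le : B₄ ≤ B := le_trans (le_max_right _ _) (le_max_right _ _)
  have hS1 := h₁ X hX₁ 3 (x + 2) y z K (by norm_num) hhi1 hzX hKy1 (hreg B₁ hB₁le hlo1)
    (hreg' hlo1)
  have hS2 := h₂ X hX₂ 2 (x / 2 + 1) y z K (by norm_num) hhi2 hzX hKy2 (hreg B₂ hB₂le hlo2)
    (hreg' hlo2)
  have hS3 := h₃ X hX₃ 1 x y z K le_rfl hhi3 hzX hKy3 (hreg B₃ hB₃le hlo3) (hreg' hlo3)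
  have hS4 := h₄ X hX₄ 1 (x / 2) y z K le_rfl hhi4 hzX hKy4 (hreg B₄ hB₄le le_rfl)
    (hreg' le_rfl)
  -- `|U| ≤` the four sums over `q ≤ z`
  rw [twinUnbalancedSum_eq_switched hzy x]
  set F : ℕ → ℝ := fun q => switchedSum 3 (x + 2) q 2 2 (twinSwitchWeight y q)
      + switchedSum 2 (x / 2 + 1) q 1 1 (twinSwitchWeight y q)
      + switchedSum 1 x q 2 (-2) (twinSwitchWeight y q)
      + switchedSum 1 (x / 2) q 1 (-1) (twinSwitchWeight y q) with hFdef
  have hstep1 : |∑ q ∈ Icc 1 (x + 2), (if q ≤ z then F q else 0)| ≤ ∑ q ∈ Icc 1 z, |F q| := by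
    refine (abs_sum_le_sum_abs _ _).trans ?_
    have : ∑ q ∈ Icc 1 (x + 2), |(if q ≤ z then F q else 0)|
        = ∑ q ∈ (Icc 1 (x + 2)).filter (fun q => q ≤ z), |F q| := by
      rw [sum_filter]
      refine sum_congr rfl fun q _ => ?_
      split_ifs <;> simp
    rw [this]
    refine sum_le_sum_of_subset_of_nonneg ?_ fun _ _ _ => abs_nonneg _
    intro q hq
    rw [mem_filter, mem_Icc] at hq
    rw [mem_Icc]
    exact ⟨hq.1.1, hq.2⟩
  have hstep2 : ∑ q ∈ Icc 1 z, |F q|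
      ≤ ∑ q ∈ Icc 1 z, (|switchedSum 3 (x + 2) q 2 2 (twinSwitchWeight y q)|
          + |switchedSum 2 (x / 2 + 1) q 1 1 (twinSwitchWeight y q)|
          + |switchedSum 1 x q 2 (-2) (twinSwitchWeight y q)|
          + |switchedSum 1 (x / 2) q 1 (-1) (twinSwitchWeight y q)|) := by
    refine sum_le_sum fun q _ => ?_
    simp only [hFdef]
    exact (abs_add_le _ _).trans (add_le_add (abs_add_three _ _ _) le_rfl)
  have hLA : 0 < Real.log X ^ A := Real.rpow_pos_of_pos hLX0 _
  have hLxA : 0 < Real.log (x : ℝ) ^ A :=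
    Real.rpow_pos_of_pos (by linarith [two_le_log_of_nine_le hx9]) _
  have hconv : X / Real.log X ^ A ≤ 3 * x / Real.log (x : ℝ) ^ A := by
    have hlog : Real.log (x : ℝ) ≤ Real.log X := Real.log_le_log (by linarith) hxX
    have hpow : Real.log (x : ℝ) ^ A ≤ Real.log X ^ A :=
      Real.rpow_le_rpow (by linarith [two_le_log_of_nine_le hx9]) hlog hA.le
    calc X / Real.log X ^ A ≤ X / Real.log (x : ℝ) ^ A :=
          div_le_div_of_nonneg_left (by linarith) hLxA hpow
      _ ≤ 3 * x / Real.log (x : ℝ) ^ A := by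
          refine div_le_div_of_nonneg_right ?_ hLxA.le
          rw [hXdef]; linarith
  have hF : (fun q => if q ≤ z then F q else 0)
      = fun q => if q ≤ z then switchedSum 3 (x + 2) q 2 2 (twinSwitchWeight y q)
          + switchedSum 2 (x / 2 + 1) q 1 1 (twinSwitchWeight y q)
          + switchedSum 1 x q 2 (-2) (twinSwitchWeight y q)
          + switchedSum 1 (x / 2) q 1 (-1) (twinSwitchWeight y q) else 0 := by
    rfl
  rw [← hF]
  calc |∑ q ∈ Icc 1 (x + 2), (if q ≤ z then F q else 0)|
      ≤ ∑ q ∈ Icc 1 z, |F q| := hstep1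
    _ ≤ _ := hstep2
    _ = ∑ q ∈ Icc 1 z, |switchedSum 3 (x + 2) q 2 2 (twinSwitchWeight y q)|
        + ∑ q ∈ Icc 1 z, |switchedSum 2 (x / 2 + 1) q 1 1 (twinSwitchWeight y q)|
        + ∑ q ∈ Icc 1 z, |switchedSum 1 x q 2 (-2) (twinSwitchWeight y q)|
        + ∑ q ∈ Icc 1 z, |switchedSum 1 (x / 2) q 1 (-1) (twinSwitchWeight y q)| := by
        rw [sum_add_distrib, sum_add_distrib, sum_add_distrib]
    _ ≤ C₁ * X / Real.log X ^ A + C₂ * X / Real.log X ^ A + C₃ * X / Real.log X ^ A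
        + C₄ * X / Real.log X ^ A := add_le_add (add_le_add (add_le_add hS1 hS2) hS3) hS4
    _ = (C₁ + C₂ + C₃ + C₄) * (X / Real.log X ^ A) := by ring
    _ ≤ (C₁ + C₂ + C₃ + C₄) * (3 * x / Real.log (x : ℝ) ^ A) :=
        mul_le_mul_of_nonneg_left hconv (by positivity)
    _ = 3 * (C₁ + C₂ + C₃ + C₄) * x / Real.log (x : ℝ) ^ A := by ring

end Summit.Parity.BatemanHorn.Theorems
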